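import Summits.BirchSwinnertonDyer.BirchSwinnertonDyer.Theorems.ManinLocalTwoThreeConwayDefectTransfer
import Summits.BirchSwinnertonDyer.Rank1Residual.ManinAdditive.IZeroStarInertiaLaws
import HarnessLib

/-!
# S-desc-CDT `ConwayDefectTransfer` HOLDS (by name) — and its E-facing consequence made unconditional

Summit `BirchSwinnertonDyer`, sub-problem `BirchSwinnertonDyer`, route `ManinLocalTwoThree`; width seat `bsd-line-manin23-p2`
(gen 9), `--supports` the crux C2 `ManinOddAtFour` (stmt-BirchSwinnertonDyer-22967).  Cell `bsd-f2-manin`, descent lens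
desc g7 (MEMO-desc §24, ask P-desc-1; the row was typed later by the typer in `…ManinAdditive.IZeroStarInertiaLaws` as the
`@[conjecture]` node `ConwayCut.ConwayDefectTransfer`).  The bookkeeping proof is ALREADY in the tree
(`…Theorems.ManinLocalTwoThree.conwayDefectTransfer_of_le`, file `ManinLocalTwoThreeConwayDefectTransfer.lean`, whose docstring
announces exactly this one-liner «once the row is typed»); this file only closes the node BY NAME and discharges the `hT`
hypothesis of the leaf's two consequences.

* `conwayDefectTransfer_holds : ConwayCut.ConwayDefectTransfer` — the row's extra hypotheses `4 ∣ N`, `D.f ∈ S^G` are not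
  needed by the bookkeeping (`Λ ≤ S^G`, finite `f`-line index with a 2-adic DEFECT ⟹ no Néron congruence depth at `2`).
* `two_dvd_manin_or_not_lieSaturated_of_conwayDefect'` — the leaf's E-facing consequence with `hT` discharged: a Conway
  defect on the `f`-line forces `2 ∣ c_E ∨ ¬ LieSaturatedAt 2`.
* `not_lieSaturatedAt_two_of_primitive'` — the leaf's chain on the primitive class with `hT` discharged (still conditional
  on the LAW E-desc-48 `PrimitiveIZeroStarDefectLawAtTwo`, passed by name).

Elementary.  BSD is not proved by this; Manin's conjecture is not proved by this; C2 is not closed by this.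
-/

set_option autoImplicit false
set_option linter.dupNamespace false

noncomputable section

open scoped MatrixGroups ModularForm
open CongruenceSubgroup WeierstrassCurve
open Literature.NumberTheory.EllipticCurves Literature.NumberTheory.EllipticCurves.ModularForms
open Summit.BirchSwinnertonDyer.Rank1Residual.ManinAdditive
open Summit.BirchSwinnertonDyer.Rank1Residual.ManinAdditive.ConwayCut

namespace Summit.BirchSwinnertonDyer.BirchSwinnertonDyer.Theorems.ManinLocalTwoThree

/-- **S-desc-CDT `ConwayDefectTransfer` HOLDS** (desc g7 support row, typed `@[conjecture]` node
`ConwayCut.ConwayDefectTransfer`): for a Néron `f`-line datum with `Λ ≤ S^G`, finite `f`-line index `r = [e_f S^G : ℤ f]`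
and a 2-adic Conway defect `ord₂ r < ord₂ deg φ`, there is NO Néron congruence depth at `2`.  One line over the tree's
`conwayDefectTransfer_of_le` (the hypotheses `4 ∣ N`, `D.f ∈ S^G` of the row are unused). -/
theorem conwayDefectTransfer_holds : ConwayDefectTransfer :=
  fun _ _ _ _ _ Δ _ _ hΛ hdef hfin => conwayDefectTransfer_of_le Δ hΛ hdef hfin

/-- **E-facing consequence, unconditional**: a 2-adic Conway defect on the `f`-line (`Λ ≤ S^G`, `ord₂ r < ord₂ deg φ`,
`r ≠ 0`) forces `2 ∣ c_E` or failure of Lie-saturation of `E → J₀(N)` at `2` (the leaf's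
`two_dvd_manin_or_not_lieSaturated_of_conwayDefect` with `hT := conwayDefectTransfer_holds`). -/
theorem two_dvd_manin_or_not_lieSaturated_of_conwayDefect' {N : ℕ} [NeZero N]
    {W : WeierstrassCurve ℚ} [W.IsElliptic] {D : ModularParametrizationData W N} (Δ : NeronFLineDatum W D)
    (h4 : 4 ∣ N) (hfM : D.f ∈ conwayStableLattice N) (hΛ : Δ.Λ ≤ conwayStableLattice N)
    (hdef : padicValNat 2 (lineIndex (conwayStableLattice N) D.f) < padicValNat 2 D.modularDegree)
    (hfin : lineIndex (conwayStableLattice N) D.f ≠ 0) :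
    (2 : ℤ) ∣ D.maninConstant ∨ ¬ Δ.LieSaturatedAt 2 :=
  two_dvd_manin_or_not_lieSaturated_of_conwayDefect conwayDefectTransfer_holds Δ h4 hfM hΛ hdef hfin

/-- **The primitive-class chain with `hT` discharged** (conditional only on the LAW E-desc-48
`PrimitiveIZeroStarDefectLawAtTwo`): for an optimal class-A curve with `e₂ = 24` and `2 ∤ c_E`, the optimal map
`E → J₀(N)` is not Lie-saturated at `2`. -/
theorem not_lieSaturatedAt_two_of_primitive' (h48 : PrimitiveIZeroStarDefectLawAtTwo)
    (W : WeierstrassCurve ℚ) [W.IsElliptic] [W.IsGloballyMinimal] [NeZero (W.conductorNorm ℤ)]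
    (D : ModularParametrizationData W (W.conductorNorm ℤ)) (Δ : NeronFLineDatum W D)
    (hL : ∀ z ∈ D.L.lattice, ∃ w ∈ periodLattice D.f, z = D.c * w)
    (hopt : ∀ (W' : WeierstrassCurve ℚ) [W'.IsElliptic]
        (D' : ModularParametrizationData W' (W.conductorNorm ℤ)),
        D'.f = D.f → D.modularDegree ≤ D'.modularDegree)
    (h4 : 4 ∣ W.conductorNorm ℤ) (hA : IsTorsionFreeIZeroStarAtTwo W) (he : W.semistabilityDefectAt 2 = 24)
    (hfM : D.f ∈ conwayStableLattice (W.conductorNorm ℤ)) (hΛ : Δ.Λ ≤ conwayStableLattice (W.conductorNorm ℤ))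
    (hfin : lineIndex (conwayStableLattice (W.conductorNorm ℤ)) D.f ≠ 0)
    (hc : ¬ (2 : ℤ) ∣ D.maninConstant) : ¬ Δ.LieSaturatedAt 2 :=
  not_lieSaturatedAt_two_of_primitive h48 conwayDefectTransfer_holds W D Δ hL hopt h4 hA he hfM hΛ hfin hc

end Summit.BirchSwinnertonDyer.BirchSwinnertonDyer.Theorems.ManinLocalTwoThree

end
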